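import Summits.Ventures.PercRepro.S1TriangleQ
import Summits.Ventures.PercRepro.S1CellCaps

/-!
# PercRepro — the cells `(11, 10)`, `(10, 12)` and `(9, 17)` of the `q = 4` window, by LEMMA Q (p2, gen 17)

With the triangle bound `s₃ ≤ cq d` of LEMMA Q (`25` at corank `10`, `36` at corank `12`, `81` at corank `17`; the
cell's earlier `(d² − 3d + 6)/2` gave `38`, `57`, `125`), the capped cell inequality `cellOK10 p d (cq d) S` holds
at `(11, 10)`, `(10, 12)` and `(9, 17)` with no four-circuit cap (`S = C(d + 3, 4)`, the circuit count of nullity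
`d` — a tree theorem), so the `e`-free cores of rank `11` with `21` points, of rank `10` with `22` points and of
rank `9` with `26` points satisfy `RLS` at level `4`: three cells of the rows `11`, `10`, `9` closed unconditionally
(twin: mining/p2/g17/qcells.py — `0.888`, `0.9465`, `0.9192`).

* `ncard_fourCircuits_le_choose` — `s₄ ≤ C(d + 3, 4)` at nullity `d` (`ncard_circuits_le_choose` at `k = 3`);
* `cell_eleven_ten_q`, `cell_ten_twelve_q`, `cell_nine_seventeen_q` — the three kernel cells;
* **`c025_core_eleven_ten`**, **`c025_core_ten_twelve`**, **`c025_core_nine_seventeen`** — the cores.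
Axioms: standard.
-/

open scoped Matroid

namespace PercRepro

namespace S1

open Set

variable {α : Type}

/-- **`s₄ ≤ C(d + 3, 4)`**: the circuits with `4` elements of a matroid of nullity `d` (the circuit count
`ncard_circuits_le_choose` at `k = 3`). -/
theorem ncard_fourCircuits_le_choose (M : Matroid α) [M.Finite] {d : ℕ}
    (hd : M.E.encard = M.eRank + d) :
    {C : Set α | M.IsCircuit C ∧ C.ncard = 4}.ncard ≤ (d + 3).choose 4 := by
  have hν : M✶.eRank = (d : ℕ∞) := by
    have h := _root_.Matroid.eRank_add_eRank_dual M
    rw [hd] at h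
    exact WithTop.add_left_cancel (PercRepro.Matroid.eRank_ne_top_of_finite M) h
  have h := PercRepro.Matroid.ncard_circuits_le_choose M hν 3
  simpa using h

/-- The cell `(11, 10)` with `s₃ ≤ 25` (LEMMA Q) and `s₄ ≤ C(13, 4) = 715`. -/
theorem cell_eleven_ten_q : cellOK10 11 10 25 715 = true := by decide +kernel

/-- The cell `(10, 12)` with `s₃ ≤ 36` (LEMMA Q) and `s₄ ≤ C(15, 4) = 1365`. -/
theorem cell_ten_twelve_q : cellOK10 10 12 36 1365 = true := by decide +kernel

/-- The cell `(9, 17)` with `s₃ ≤ 81` (LEMMA Q) and `s₄ ≤ C(20, 4) = 4845`. -/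
theorem cell_nine_seventeen_q : cellOK10 9 17 81 4845 = true := by decide +kernel

/-- **THE CELL `(11, 10)`**: an `e`-free core of rank `11` with `21` points satisfies `RLS` at level `4`. -/
theorem c025_core_eleven_ten (M : Matroid α) [M.Finite] (hR : M.eRank = (11 : ℕ)) (hn : M.E.ncard = 21)
    (hfree : ∀ e ∈ M.E, ∃ A ⊆ M.E \ {e}, e ∉ M.closure A ∧ e ∉ M.closure ((M.E \ {e}) \ A)) :
    ThmN.RLS M 11 4 := by
  have hd : M.E.encard = M.eRank + ((10 : ℕ) : ℕ∞) := by
    rw [hR, ← M.ground_finite.cast_ncard_eq, hn]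
    push_cast
    ring
  have hP : {C : Set α | M.IsCircuit C ∧ C.ncard = 3}.ncard ≤ 25 := by
    have h := core_ncard_triangles_le_cq M hfree hd
    rwa [show cq 10 = 25 by decide] at h
  have hS : {C : Set α | M.IsCircuit C ∧ C.ncard = 4}.ncard ≤ 715 :=
    (ncard_fourCircuits_le_choose M hd).trans (by decide)
  exact rls_of_cellOK10 M 11 10 25 715 (by norm_num) hR hn hfree hP hS (by norm_num) cell_eleven_ten_q

/-- **THE CELL `(10, 12)`**: an `e`-free core of rank `10` with `22` points satisfies `RLS` at level `4`. -/
theorem c025_core_ten_twelve (M : Matroid α) [M.Finite] (hR : M.eRank = (10 : ℕ)) (hn : M.E.ncard = 22)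
    (hfree : ∀ e ∈ M.E, ∃ A ⊆ M.E \ {e}, e ∉ M.closure A ∧ e ∉ M.closure ((M.E \ {e}) \ A)) :
    ThmN.RLS M 10 4 := by
  have hd : M.E.encard = M.eRank + ((12 : ℕ) : ℕ∞) := by
    rw [hR, ← M.ground_finite.cast_ncard_eq, hn]
    push_cast
    ring
  have hP : {C : Set α | M.IsCircuit C ∧ C.ncard = 3}.ncard ≤ 36 := by
    have h := core_ncard_triangles_le_cq M hfree hd
    rwa [show cq 12 = 36 by decide] at h
  have hS : {C : Set α | M.IsCircuit C ∧ C.ncard = 4}.ncard ≤ 1365 :=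
    (ncard_fourCircuits_le_choose M hd).trans (by decide)
  exact rls_of_cellOK10 M 10 12 36 1365 (by norm_num) hR hn hfree hP hS (by norm_num) cell_ten_twelve_q

/-- **THE CELL `(9, 17)`**: an `e`-free core of rank `9` with `26` points satisfies `RLS` at level `4`. -/
theorem c025_core_nine_seventeen (M : Matroid α) [M.Finite] (hR : M.eRank = (9 : ℕ)) (hn : M.E.ncard = 26)
    (hfree : ∀ e ∈ M.E, ∃ A ⊆ M.E \ {e}, e ∉ M.closure A ∧ e ∉ M.closure ((M.E \ {e}) \ A)) :
    ThmN.RLS M 9 4 := by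
  have hd : M.E.encard = M.eRank + ((17 : ℕ) : ℕ∞) := by
    rw [hR, ← M.ground_finite.cast_ncard_eq, hn]
    push_cast
    ring
  have hP : {C : Set α | M.IsCircuit C ∧ C.ncard = 3}.ncard ≤ 81 := by
    have h := core_ncard_triangles_le_cq M hfree hd
    rwa [show cq 17 = 81 by decide] at h
  have hS : {C : Set α | M.IsCircuit C ∧ C.ncard = 4}.ncard ≤ 4845 :=
    (ncard_fourCircuits_le_choose M hd).trans (by decide +kernel)
  exact rls_of_cellOK10 M 9 17 81 4845 (by norm_num) hR hn hfree hP hS (by norm_num) cell_nine_seventeen_q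

end S1

end PercRepro
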